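import Summits.QuantumFields.BalabanUV.T4Continuum.Support.ShellMeasureLandauEndFinal
import Summits.QuantumFields.BalabanUV.T4Continuum.Support.ShellMeasureLandauWilsonSquaresPinned
import Summits.QuantumFields.BalabanUV.T4Continuum.Support.ShellMeasureRayTermsPinnedLandau
import Summits.QuantumFields.BalabanUV.T4Continuum.Support.ShellMeasureRayLogIntegral

/-!
# `T4Continuum.ShellMeasureLandauEndRayStokesAssembled` — row S80 «END-II-final ASSEMBLED»: S76 f2's two-slot live-level
# END with BOTH 𝓔-slots DISCHARGED by the suppliers of record — the Wilson slot by S74 f2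
# `hE_landau_wilsonSquares_pinned` (+ the Wilson density's NONNEGATIVITY, proved here), the non-Wilson slot by S71 f2
# `hE_landau_chartRay_pinned` ⊕ S78 `rayBound_of_logIntegral` through `rayBound_add` — leaving ONLY located binders
(cell `pub-balaban`, sub-cell `t4`, spine estimate NE7c (node U5b); NE7c ROUND-2 crew, unit
`b2b-balaban-t4-ne7c-formalise-leaf-04` gen 6; owner table `t4/b2b-balaban-t4-ne7c-p1/LEAVES-NE7c-P1.md` v3.5 row **S80**
(owner g31 GO at seat close, journal l.17574, on OFFER l.17401); ADDITIVE — imports S76 f2 `ShellMeasureLandauEndFinal`, S74 f2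
`ShellMeasureLandauWilsonSquaresPinned`, S71 f2 `ShellMeasureRayTermsPinnedLandau`, S78 `ShellMeasureRayLogIntegral` ONLY; every
supplier consumed BY NAME; [folklore]; 0 `def`, 0 `def … : Prop`, 0 sorry, 0 citation tags)

HONEST FRAMING.  Finite four-torus programme, rung (B)+1 only — NOT infinite volume, NOT a mass gap, NOT the Clay
problem, NOT summit progress; (B), `BetaPertHyp`, (B^μ) not consumed.  NE7c (`T4IndicatorShell.ShellWeightBound`) is
NOT PRINTED and NOT PROVED; «NE7c ⇐ the named binders» (+ F-ne7cp1-g30-1 decay halves, + F-ne7cp1-g31-1 curl read-out);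
(M1) realized ≠ NE7c (c3).  Nothing printed is asserted: the equation numbers in binder comments LOCATE displayed SHAPES
((P2), (P4), (118)∕(121), (103), (75), (44), (46), (54); B11 (19)∕(25)∕(37); B12 (2.18)–(2.22); B14 (2.17)), not citations.
HONEST DEPENDENCY (cell): continuum YM on T⁴ ⇐ BetaPertH ∧ nine spine estimates (0/9 proved); BetaPertH ⇐ (D1) ∧ (D4) ∧
CAP+tail; G-an2-4 gates asym, D1 and NE2/3/4.

THE THREE TUPLES (RULING R-ne7cp1-g31-2 «two tuples by modularity», displayed, not reconciled here): (T1) the LOCALIZED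
(classifier) scheme tuple of the END, flat norms (S76); (T2) the GLOBAL scheme tuple read through displayed pinned readings
`π𝒴, …` (S74 f2, leaf-07-g6's pinned chain binders); (T3) the global tuple's PINNED INSTANCE `𝒴 := WSup (pinW δ′ ϖ) 1 𝔄`
(S71 f2).  (T2)∕(T3) are two typings of the same exponent field — `ShellMeasureLandauPinnedTransfer.solAt_eq_toPiL_solAt`
reconciles them; NOT done here: each supplier's data are DISPLAYED as that supplier states them.
* §1 `wilsonDensity_nonneg` — `U·Uᴴ = 1 ⇒ 0 ≤ 1 − Re tr U ∕ N` (S72 `re_trace_unitarySquare` + `re_trace_mul_conjTranspose_self`);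
  `wilsonProfile_nonneg` — the Wilson ray profile of S74 is `≥ 0` at REAL chart points of the S-ball (exponent field real by
  `landauField_mem_real`, letters skew ⇒ words unitary by S74 `listProd_exp_mem_unitary`, frozen `B_p` unitary).
* §2 **`slotAC_realized_su2_landauChart_assembled`** — S76 f2 `…_final` with `hEW := S74 hE_landau_wilsonSquares_pinned`
  (per exterior section `V`), `hWlb := §1`, `hEE := rayBound_add (S71 f2 hE_landau_chartRay_pinned) (S78 rayBound_of_logIntegral)`,
  slot constant `2(m₀ + (3H̄_W∕(r_Φ,w∕S − 1) + (3·LK·2z̄_e∕(r_Φ,e∕S − 1) + B_d)))∕(1−δ)`.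
WHAT REMAINS A BINDER (c3): scheme∕read-out∕real-structure data of the three tuples, the pinned chain readings, the
located budgets `H̄_W` (S74 §4 locates it), `LK` (S71 §3), the ω-uniform ray constant `B_d` with `hint`∕`hpos` (S78), the
lower bounds of the two non-Wilson parts on the S-ball, co-test∕window data, numbers, [dict].  No estimate of Bałaban's is
discharged; NOTHING in the countdown moves.
-/

noncomputable section

open Set Metric NormedSpace MeasureTheory Function

namespace Summit.QuantumFields.BalabanUV.T4Continuum.ShellMeasureLandauEndRayStokesAssembled

open scoped ENNReal
open Literature.MathematicalPhysics.QuantumFieldTheory.Balaban1983to89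
open B11Prop6Scheme (Prop4Hyp)
open GaugeField (GaugeInvariant)
open T4ShellMeasure (SlotAntiConcentration)
open T4CubePoincare (cube)
open T4CubeChartGnomonic (SU2)
open T4CubeChartExp (expFibreChart)
open T4TreeGaugeFixing (NoClosedLoop fixTo)
open T4ShellMeasurePlaquette (expTail₂)
open ShellMeasureWilsonWords (wordExp)
open ShellMeasureLevelAssembly (classifier)
open ShellMeasureMultiGridNorms (WSup)
open ShellMeasurePinnedNorm (pinW)
open ShellMeasureLandauHolonomy (solAt landauExp)
open ShellMeasureLandauHolonomyChart (holOf holOf_apply cplx)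
open ShellMeasureLandauHolonomySkew (readOutReal)
open ShellMeasureLandauHolonomyReal (landauField_mem_real)
open ShellMeasureWilsonSquare (re_trace_unitarySquare re_trace_mul_conjTranspose_self)
open ShellMeasureLandauWilsonSquares (listProd_exp_mem_unitary)
open ShellMeasureLandauWilsonSquaresPinned (hE_landau_wilsonSquares_pinned)
open ShellMeasureRayTermsPinnedLandau (hE_landau_chartRay_pinned)
open ShellMeasureRayLogIntegral (rayBound_of_logIntegral rayBound_add)
open ShellMeasureLandauEndFinal (slotAC_realized_su2_landauChart_final)
open ShellMeasureWindowBall (window_of_ballSupport)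

/-! ## §1 The Wilson density is nonnegative (unitarity) -/

section Wilson

open scoped Matrix Matrix.Norms.L2Operator

variable {n : Type*} [Fintype n] [DecidableEq n]

/-- **`U·Uᴴ = 1 ⇒ 0 ≤ 1 − Re tr U ∕ N`** (`0 < N`): `N − Re tr U = ½·Re tr((U−1)(U−1)ᴴ) = ½Σ_ab ‖(U−1)_ab‖² ≥ 0`
(S72 `re_trace_unitarySquare`, `re_trace_mul_conjTranspose_self`). [folklore] -/
theorem wilsonDensity_nonneg {U : Matrix n n ℂ} (hU : U * Uᴴ = 1) (hN : 0 < Fintype.card n) {β : ℝ} (hβ : 0 ≤ β) :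
    0 ≤ β * (1 - (Matrix.trace U).re / Fintype.card n) := by
  have hsq := re_trace_unitarySquare hU
  have hnn : 0 ≤ (Matrix.trace ((U - 1) * (U - 1)ᴴ)).re := by
    rw [re_trace_mul_conjTranspose_self]; positivity
  have hN' : (0 : ℝ) < Fintype.card n := by exact_mod_cast hN
  have hle : (Matrix.trace U).re ≤ Fintype.card n := by linarith
  refine mul_nonneg hβ ?_
  rw [sub_nonneg, div_le_one hN']
  exact hle

/-- A product `B·W` of a unitary `B` and a word of exponentials of SKEW letters satisfies `(BW)(BW)ᴴ = 1`
(S74 `listProd_exp_mem_unitary`). [folklore] -/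
theorem mul_wordExp_mul_conjTranspose {B : Matrix n n ℂ} (hB : B ∈ unitary (Matrix n n ℂ)) {l : List (Matrix n n ℂ)}
    (hl : ∀ Y ∈ l, Y ∈ skewAdjoint (Matrix n n ℂ)) : (B * wordExp l) * (B * wordExp l)ᴴ = 1 := by
  have hW : wordExp l ∈ unitary (Matrix n n ℂ) := listProd_exp_mem_unitary l hl
  have hBW : B * wordExp l ∈ unitary (Matrix n n ℂ) := (unitary (Matrix n n ℂ)).mul_mem hB hW
  have h := Unitary.mul_star_self_of_mem hBW
  rwa [Matrix.star_eq_conjTranspose] at h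

end Wilson

/-! ## §1b The Wilson ray profile of S74 is nonnegative at real chart points -/

section Profile

open scoped Matrix Matrix.Norms.L2Operator

variable {n : Type*} [Fintype n] [DecidableEq n] [Nonempty n]
variable {𝒴 𝒴' 𝒳 𝒵 ℬ : Type*} [NormedAddCommGroup 𝒴] [NormedSpace ℂ 𝒴] [CompleteSpace 𝒴]
  [NormedAddCommGroup 𝒴'] [NormedSpace ℂ 𝒴'] [NormedAddCommGroup 𝒳] [NormedSpace ℂ 𝒳] [CompleteSpace 𝒳]
  [NormedAddCommGroup 𝒵] [NormedSpace ℂ 𝒵] [NormedAddCommGroup ℬ] [NormedSpace ℂ ℬ]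
variable {m₀ : ℕ} {𝒢 : 𝒵 →L[ℂ] 𝒴} {W𝒱 : 𝒴 → 𝒵} {B₀ C₄ a₃ : ℝ}

/-- **THE WILSON RAY PROFILE IS NONNEGATIVE AT REAL CHART POINTS.**  Under the chain's flat binders ((P2), (P4), (118)∕(121),
(103), (75)-TYPE, (44), scaling, (46), (54)) and the real structure with SKEW weight read-outs (chain (A)∕(E)), at a real
chart point `y` with `‖y‖ ≤ S` the exponent field is real (`landauField_mem_real`), every weight letter is skew, every
weight word is unitary (S74 `listProd_exp_mem_unitary`), and with a frozen UNITARY prefactor `B_p` and `0 ≤ β` each Wilson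
summand `β(1 − Re tr(B_p·W_p(y))∕N)` is `≥ 0` (§1).  The `hWlb` input of S76 f2. [folklore] -/
theorem wilsonProfile_nonneg {𝔭 : Type*} (Pw : Finset 𝔭) {S : ℝ}
    (h𝒢 : ∀ f, ‖𝒢 f‖ ≤ B₀ * ‖f‖) (hW : Prop4Hyp W𝒱 C₄ a₃) (hB₀ : 0 < B₀) (hC₄ : 0 ≤ C₄)
    {b ε₄ : ℝ} (hε₄ : 0 ≤ ε₄) (hdom : 2 * (ε₄ + B₀ * b) ≤ a₃)
    (hself : B₀ * C₄ * (ε₄ + B₀ * b) ^ 2 ≤ ε₄) (hcontr : 4 * B₀ * C₄ * (ε₄ + B₀ * b) < 1)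
    (H₁ : ℬ →L[ℂ] 𝒴) (hH₁ : ∀ B, ‖H₁ B‖ ≤ B₀ * ‖B‖)
    {Φ : (Fin m₀ → ℂ) → ℬ} {rΦ : ℝ} (hΦ : ∀ z ∈ ball (0 : Fin m₀ → ℂ) rΦ, ‖Φ z‖ < b) (hSr : S < rΦ)
    {C : 𝒴' → 𝒳} {C₂ R : ℝ} (hC₂ : 0 ≤ C₂) (hCq : ∀ Z : 𝒴', ‖Z‖ < R → ‖C Z‖ ≤ C₂ * ‖Z‖ ^ 2)
    (hCd : DifferentiableOn ℂ C (ball 0 R)) (ι : 𝒴 →L[ℂ] 𝒴') (hι : ∀ Y, ‖ι Y‖ ≤ ‖Y‖) (H : 𝒳 →L[ℂ] 𝒴)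
    (hH : ∀ X, ‖H X‖ ≤ B₀ * ‖X‖) (hq : 9 * C₂ * B₀ * (ε₄ + B₀ * b) < 1) (hRC : 3 * (ε₄ + B₀ * b) ≤ R)
    (ℓw : 𝔭 → List (𝒴 →L[ℂ] Matrix n n ℂ))
    (𝓡𝒴 : AddSubgroup 𝒴) (h𝓡𝒴 : IsClosed (𝓡𝒴 : Set 𝒴)) (𝓡𝒵 : AddSubgroup 𝒵) (𝓡𝒴' : AddSubgroup 𝒴')
    (𝓡𝒳 : AddSubgroup 𝒳) (h𝓡𝒳 : IsClosed (𝓡𝒳 : Set 𝒳)) (𝓡ℬ : AddSubgroup ℬ)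
    (h𝒢r : ∀ f ∈ 𝓡𝒵, 𝒢 f ∈ 𝓡𝒴) (hWr : ∀ Y ∈ 𝓡𝒴, W𝒱 Y ∈ 𝓡𝒵) (hιr : ∀ Y ∈ 𝓡𝒴, ι Y ∈ 𝓡𝒴')
    (hHr : ∀ X ∈ 𝓡𝒳, H X ∈ 𝓡𝒴) (hCr : ∀ Z ∈ 𝓡𝒴', C Z ∈ 𝓡𝒳) (hH₁r : ∀ B ∈ 𝓡ℬ, H₁ B ∈ 𝓡𝒴)
    (hΦr : ∀ y : Fin m₀ → ℝ, ‖y‖ ≤ S → Φ (cplx y) ∈ 𝓡ℬ)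
    (hskew : ∀ p ∈ Pw, ∀ ℓ ∈ ℓw p, ∀ Y ∈ 𝓡𝒴, ℓ Y ∈ skewAdjoint (Matrix n n ℂ))
    (Bp : 𝔭 → Matrix n n ℂ) (hBu : ∀ p ∈ Pw, Bp p ∈ unitary (Matrix n n ℂ)) {β : ℝ} (hβ : 0 ≤ β)
    {y : Fin m₀ → ℝ} (hy : ‖y‖ ≤ S) :
    0 ≤ ∑ p ∈ Pw, β * (1 - (Matrix.trace (Bp p * holOf (ℓw p) (fun y => landauExp C ι H
        (4 * C₂ * (ε₄ + B₀ * b) ^ 2) (solAt 𝒢 0 W𝒱 ε₄ (0 : 𝒵) (H₁ (Φ (cplx y))) + H₁ (Φ (cplx y)))) y)).re /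
          Fintype.card n) := by
  have hmem := landauField_mem_real h𝒢 hW hB₀ hC₄ hε₄ hdom hself hcontr H₁ hH₁ hΦ hSr hC₂ hCq hCd ι hι H hH hq hRC
    𝓡𝒴 h𝓡𝒴 𝓡𝒵 𝓡𝒴' 𝓡𝒳 h𝓡𝒳 𝓡ℬ h𝒢r hWr hιr hHr hCr hH₁r hΦr hy
  refine Finset.sum_nonneg fun p hp => ?_
  rw [holOf_apply]
  refine wilsonDensity_nonneg (mul_wordExp_mul_conjTranspose (hBu p hp) fun Y hY => ?_) Fintype.card_pos hβ
  obtain ⟨ℓ, hℓ, rfl⟩ := List.mem_map.1 hY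
  exact hskew p hp ℓ hℓ _ hmem

end Profile

/-! ## §2 END-II-final ASSEMBLED -/

section Assembled

open scoped Matrix.Norms.L2Operator

variable {P : Params} {j : ℕ} [DecidableEq (PBond P j)]
variable {n : Type*} [Fintype n] [DecidableEq n] [Nonempty n]
variable {𝒴 𝒴' 𝒳 𝒵 ℬ : Type*} [NormedAddCommGroup 𝒴] [NormedSpace ℂ 𝒴] [CompleteSpace 𝒴]
  [NormedAddCommGroup 𝒴'] [NormedSpace ℂ 𝒴'] [NormedAddCommGroup 𝒳] [NormedSpace ℂ 𝒳] [CompleteSpace 𝒳]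
  [NormedAddCommGroup 𝒵] [NormedSpace ℂ 𝒵] [NormedAddCommGroup ℬ] [NormedSpace ℂ ℬ]

/-- **END-II-FINAL, ASSEMBLED** (row S80): S76 f2 `ShellMeasureLandauEndFinal.slotAC_realized_su2_landauChart_final` with
BOTH 𝓔-slots DISCHARGED by the suppliers of record, per exterior section `V` — the Wilson slot by S74 f2
`hE_landau_wilsonSquares_pinned` over (T2) with its nonnegativity `hWlb` by §1b, the non-Wilson slot by S71 f2
`hE_landau_chartRay_pinned` over (T3) ⊕ S78 `rayBound_of_logIntegral` through `rayBound_add`; the density's sections on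
the chart cube are `Jco · exp(−(Σ_p β(1 − Re tr(B_p W_p)∕N) + Re Σ_i 𝐄_i + (−log ∫ g e^{A} dμ)))` of the DEFINED profiles.
CONCLUSION: (M1) per slot at the classifier threshold `εθ·η²` with the slot constant
`2(m₀ + (3H̄∕(r_Φ,w∕S − 1) + (3·LK·2z̄_e∕(r_Φ,e∕S − 1) + B_d)))∕(1 − δ)`.  Every hypothesis is a scheme∕read-out∕real-structure
datum of one of the three displayed tuples, a located budget (`H̄`, `LK`, `B_d`), a lower bound, a co-test∕window datum or
a number; CONDITIONAL on all of them; nothing PRINTED is asserted; NOT Bałaban's minimiser; (M1) realized ≠ NE7c. [folklore] -/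
theorem slotAC_realized_su2_landauChart_assembled {T : Finset (PBond P j)} (hT : NoClosedLoop T)
    (U₀ : GaugeField P j SU2) (Λ : Finset (PBond P j)) {m₀ : ℕ} (e : ↥Λ × Fin 3 ≃ Fin m₀)
    {S : ℝ} (hS : 0 < S) (hSπ : 3 * S ^ 2 < Real.pi ^ 2) (c : GaugeField P j SU2 → GaugeField P j SU2)
    {F : GaugeField P j SU2 → ℝ≥0∞} (hF : Measurable F) (hFi : GaugeInvariant F)
    (hFsupp : ∀ V y, F (fixTo T U₀ (updateFinset V Λ y)) ≠ 0 →
      ∀ b (hb : b ∈ Λ), dist1 ((c V b)⁻¹ * y ⟨b, hb⟩) ≤ 2 * Real.sin (S / 2))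
    {u : GaugeField P j SU2 → ℝ} (hu : Measurable u) (hui : GaugeInvariant u)
    {ι : Type*} {Pu : Finset ι} (hPu : Pu.Nonempty)
    (W : GaugeField P j SU2 → Set (Fin m₀ → ℝ)) (Jco : GaugeField P j SU2 → (Fin m₀ → ℝ) → ℝ≥0∞)
    {δ ρ β : ℝ}
    (𝒢 : GaugeField P j SU2 → (𝒵 →L[ℂ] 𝒴)) (W𝒱 : GaugeField P j SU2 → 𝒴 → 𝒵) {B₀ C₄ a₃ ε₄ : ℝ}
    (h𝒢 : ∀ V f, ‖𝒢 V f‖ ≤ B₀ * ‖f‖) (hW : ∀ V, Prop4Hyp (W𝒱 V) C₄ a₃) (hB₀ : 0 < B₀) (hC₄ : 0 ≤ C₄)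
    (hε₄ : 0 ≤ ε₄)
    {dL C₁ B₃ ε₁ : ℝ} (hdL : 0 ≤ dL) (hC₁ : 0 ≤ C₁) (hε₁ : 0 ≤ ε₁) (hB₃ : dL ≤ B₃)
    (h1 : 2 * B₀ * C₁ * B₃ * ε₁ ≤ ε₄) (h2 : 4 * ε₄ ≤ a₃) (h3 : 16 * B₀ * C₄ * ε₄ ≤ 1)
    (H₁ : GaugeField P j SU2 → (ℬ →L[ℂ] 𝒴)) (hH₁ : ∀ V B, ‖H₁ V B‖ ≤ B₀ * ‖B‖)
    (Φ : GaugeField P j SU2 → (Fin m₀ → ℂ) → ℬ) {rΦ : ℝ} (hΦd : ∀ V, DifferentiableOn ℂ (Φ V) (ball 0 rΦ))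
    (hΦ0 : ∀ V, Φ V 0 = 0) (hΦ : ∀ V, ∀ z ∈ ball (0 : Fin m₀ → ℂ) rΦ, ‖Φ V z‖ < 2 * dL * C₁ * ε₁) (hSr : S < rΦ)
    (Cf : GaugeField P j SU2 → 𝒴' → 𝒳) {C₂ RC : ℝ} (hC₂ : 0 ≤ C₂)
    (hCq : ∀ V, ∀ Z : 𝒴', ‖Z‖ < RC → ‖Cf V Z‖ ≤ C₂ * ‖Z‖ ^ 2) (hCd : ∀ V, DifferentiableOn ℂ (Cf V) (ball 0 RC))
    (ιs : GaugeField P j SU2 → (𝒴 →L[ℂ] 𝒴')) (hι : ∀ V Y, ‖ιs V Y‖ ≤ ‖Y‖)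
    (Hop : GaugeField P j SU2 → (𝒳 →L[ℂ] 𝒴)) (hH : ∀ V X, ‖Hop V X‖ ≤ B₀ * ‖X‖)
    {ε₃ : ℝ} (h18 : 18 * C₂ * B₀ * ε₃ ≤ 1) (hcoup : ε₄ + B₀ * (2 * dL * C₁ * ε₁) ≤ ε₃) (h3R : 3 * ε₃ ≤ RC)
    (ℓs : ι → List (𝒴 →L[ℂ] Matrix n n ℂ)) {κr : ℝ} (hκ : 0 ≤ κr)
    (hℓ : ∀ p ∈ Pu, ∀ ℓ ∈ ℓs p, ∀ Y, ‖ℓ Y‖ ≤ κr * ‖Y‖) {m : ℕ} (hlen : ∀ p ∈ Pu, (ℓs p).length ≤ m)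
    {κc : ℝ} (hκc : 0 ≤ κc) (hcurl : ∀ p ∈ Pu, ∀ Y, ‖((ℓs p).map fun ℓ => ℓ Y).sum‖ ≤ κc * ‖Y‖)
    -- ══ (T2) THE WILSON SLOT'S SUPPLIER DATA (S74 f2 `hE_landau_wilsonSquares_pinned`, per exterior section `V`,
    -- V-uniform constants): the GLOBAL scheme tuple (P2)∕(P4)∕(118)∕(121)∕(103)∕(75)∕(44)∕scaling∕(46)∕(54), flat ══
    {𝒴w 𝒴w' 𝒳w 𝒵w ℬw P𝒴 P𝒴' P𝒳 Pℬ : Type*} [NormedAddCommGroup 𝒴w] [NormedSpace ℂ 𝒴w] [CompleteSpace 𝒴w]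
    [NormedAddCommGroup 𝒴w'] [NormedSpace ℂ 𝒴w'] [NormedAddCommGroup 𝒳w] [NormedSpace ℂ 𝒳w] [CompleteSpace 𝒳w]
    [NormedAddCommGroup 𝒵w] [NormedSpace ℂ 𝒵w] [NormedAddCommGroup ℬw] [NormedSpace ℂ ℬw]
    [NormedAddCommGroup P𝒴] [NormedSpace ℂ P𝒴] [NormedAddCommGroup P𝒴'] [NormedSpace ℂ P𝒴']
    [NormedAddCommGroup P𝒳] [NormedSpace ℂ P𝒳] [NormedAddCommGroup Pℬ] [NormedSpace ℂ Pℬ]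
    (𝒢w : GaugeField P j SU2 → (𝒵w →L[ℂ] 𝒴w)) (W𝒱w : GaugeField P j SU2 → 𝒴w → 𝒵w) {B₀w C₄w a₃w bw ε₄w : ℝ}
    (h𝒢w : ∀ V f, ‖𝒢w V f‖ ≤ B₀w * ‖f‖) (hWw : ∀ V, Prop4Hyp (W𝒱w V) C₄w a₃w) (hB₀w : 0 < B₀w) (hC₄w : 0 ≤ C₄w)
    (hε₄w : 0 ≤ ε₄w) (hdomw : 2 * (ε₄w + B₀w * bw) ≤ a₃w) (hselfw : B₀w * C₄w * (ε₄w + B₀w * bw) ^ 2 ≤ ε₄w)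
    (hcontrw : 4 * B₀w * C₄w * (ε₄w + B₀w * bw) < 1)
    (H₁w : GaugeField P j SU2 → (ℬw →L[ℂ] 𝒴w)) (hH₁w : ∀ V B, ‖H₁w V B‖ ≤ B₀w * ‖B‖)
    (Φw : GaugeField P j SU2 → (Fin m₀ → ℂ) → ℬw) {rΦw : ℝ} (hΦdw : ∀ V, DifferentiableOn ℂ (Φw V) (ball 0 rΦw))
    (hΦ0w : ∀ V, Φw V 0 = 0) (hΦbw : ∀ V, ∀ z ∈ ball (0 : Fin m₀ → ℂ) rΦw, ‖Φw V z‖ < bw) (hSrw : S < rΦw)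
    (Cw : GaugeField P j SU2 → 𝒴w' → 𝒳w) {C₂w RCw : ℝ} (hC₂w : 0 ≤ C₂w)
    (hCqw : ∀ V, ∀ Z : 𝒴w', ‖Z‖ < RCw → ‖Cw V Z‖ ≤ C₂w * ‖Z‖ ^ 2) (hCdw : ∀ V, DifferentiableOn ℂ (Cw V) (ball 0 RCw))
    (ιw : GaugeField P j SU2 → (𝒴w →L[ℂ] 𝒴w')) (hιw : ∀ V Y, ‖ιw V Y‖ ≤ ‖Y‖)
    (Hw : GaugeField P j SU2 → (𝒳w →L[ℂ] 𝒴w)) (hHw : ∀ V X, ‖Hw V X‖ ≤ B₀w * ‖X‖)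
    (hqw : 9 * C₂w * B₀w * (ε₄w + B₀w * bw) < 1) (hRCw : 3 * (ε₄w + B₀w * bw) ≤ RCw)
    -- the displayed pinned readings and leaf-07-g6's pinned chain binders (V-uniform)
    (π𝒴 : 𝒴w →L[ℂ] P𝒴) (π𝒴' : 𝒴w' →L[ℂ] P𝒴') (π𝒳 : 𝒳w →L[ℂ] P𝒳) (πℬ : ℬw →L[ℂ] Pℬ) {qW LC cι BH B₁p bp : ℝ}
    (hGWp : ∀ V, ∀ Y Y', ‖Y‖ < ε₄w + B₀w * bw → ‖Y'‖ < ε₄w + B₀w * bw →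
      ‖π𝒴 (𝒢w V (W𝒱w V Y)) - π𝒴 (𝒢w V (W𝒱w V Y'))‖ ≤ qW * ‖π𝒴 Y - π𝒴 Y'‖) (hqW : qW < 1)
    (hCp : ∀ V, ∀ A A' : 𝒴w', ‖A‖ < RCw → ‖A'‖ < RCw → ‖π𝒳 (Cw V A) - π𝒳 (Cw V A')‖ ≤ LC * ‖π𝒴' A - π𝒴' A'‖)
    (hιp : ∀ V Y, ‖π𝒴' (ιw V Y)‖ ≤ cι * ‖π𝒴 Y‖) (hHp : ∀ V X, ‖π𝒴 (Hw V X)‖ ≤ BH * ‖π𝒳 X‖)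
    (hLC : 0 ≤ LC) (hcι : 0 ≤ cι) (hBH : 0 ≤ BH) (hk : LC * cι * BH < 1)
    (hB₁p : 0 ≤ B₁p) (hH₁p : ∀ V B, ‖π𝒴 (H₁w V B)‖ ≤ B₁p * ‖πℬ B‖)
    (hΦp : ∀ V, ∀ z ∈ ball (0 : Fin m₀ → ℂ) rΦw, ‖πℬ (Φw V z)‖ ≤ bp) (hbp : 0 ≤ bp)
    -- weight plaquettes, read-outs with PINNED letter∕curl constants (S69 (B) shape; `κ_c ∝ η²`, `κ_w ∝ η` DISPLAYED)
    {𝔭 : Type*} (Pw : Finset 𝔭) (ℓw : 𝔭 → List (𝒴w →L[ℂ] Matrix n n ℂ)) {κw κcw : 𝔭 → ℝ}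
    (hκw : ∀ p ∈ Pw, 0 ≤ κw p) (hκcw : ∀ p ∈ Pw, 0 ≤ κcw p)
    (hℓwπ : ∀ p ∈ Pw, ∀ ℓ ∈ ℓw p, ∀ Y, ‖ℓ Y‖ ≤ κw p * ‖π𝒴 Y‖)
    (hcurlπ : ∀ p ∈ Pw, ∀ Y, ‖((ℓw p).map fun ℓ => ℓ Y).sum‖ ≤ κcw p * ‖π𝒴 Y‖)
    {mw : ℕ} (hlenw : ∀ p ∈ Pw, (ℓw p).length ≤ mw)
    -- the global tuple's real structure with SKEW weight read-outs
    (𝓡𝒴w : AddSubgroup 𝒴w) (h𝓡𝒴w : IsClosed (𝓡𝒴w : Set 𝒴w)) (𝓡𝒵w : AddSubgroup 𝒵w) (𝓡𝒴w' : AddSubgroup 𝒴w')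
    (𝓡𝒳w : AddSubgroup 𝒳w) (h𝓡𝒳w : IsClosed (𝓡𝒳w : Set 𝒳w)) (𝓡ℬw : AddSubgroup ℬw)
    (h𝒢rw : ∀ V, ∀ f ∈ 𝓡𝒵w, 𝒢w V f ∈ 𝓡𝒴w) (hWrw : ∀ V, ∀ Y ∈ 𝓡𝒴w, W𝒱w V Y ∈ 𝓡𝒵w)
    (hιrw : ∀ V, ∀ Y ∈ 𝓡𝒴w, ιw V Y ∈ 𝓡𝒴w') (hHrw : ∀ V, ∀ X ∈ 𝓡𝒳w, Hw V X ∈ 𝓡𝒴w)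
    (hCrw : ∀ V, ∀ Z ∈ 𝓡𝒴w', Cw V Z ∈ 𝓡𝒳w) (hH₁rw : ∀ V, ∀ B ∈ 𝓡ℬw, H₁w V B ∈ 𝓡𝒴w)
    (hΦrw : ∀ V, ∀ y : Fin m₀ → ℝ, ‖y‖ ≤ S → Φw V (cplx y) ∈ 𝓡ℬw)
    (hskew : ∀ p ∈ Pw, ∀ ℓ ∈ ℓw p, ∀ Y ∈ 𝓡𝒴w, ℓ Y ∈ skewAdjoint (Matrix n n ℂ))
    -- the frozen background plaquettes (N-ne7cp1-g31-2), the located square budget (S74 §4), `0 ≤ β`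
    (Bp : GaugeField P j SU2 → 𝔭 → Matrix n n ℂ) {d : 𝔭 → ℝ} (hBu : ∀ V, ∀ p ∈ Pw, Bp V p ∈ unitary (Matrix n n ℂ))
    (hBd : ∀ V, ∀ p ∈ Pw, ‖Bp V p - 1‖ ≤ d p) {Hbar : ℝ} (hHbar : 0 ≤ Hbar)
    (hsumw : ∑ p ∈ Pw, |β| * (d p + (κcw p * (B₁p * bp / ((1 - qW) * (1 - LC * cι * BH))) +
        expTail₂ (mw * (κw p * (B₁p * bp / ((1 - qW) * (1 - LC * cι * BH))))))) *
      (κcw p * (B₁p * bp / ((1 - qW) * (1 - LC * cι * BH))) + expTail₂ (mw * (κw p * (B₁p * bp / ((1 - qW) * (1 - LC * cι * BH)))))) ≤ Hbar)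
    -- ══ (T3) THE LOCATED NON-WILSON TERMS' SUPPLIER DATA (S71 f2 `hE_landau_chartRay_pinned`): the global tuple's PINNED
    -- INSTANCE `𝒴 := WSup (pinW δ′ ϖ) 1 𝔄`, located per-term functionals, pin depths, located sum `LK`, coupling ══
    {Λe : Type*} [Fintype Λe] {𝔄 : Type*} [NormedAddCommGroup 𝔄] [NormedSpace ℂ 𝔄] [CompleteSpace 𝔄] {δ' : ℝ} {ϖ : Λe → ℝ}
    (hδ' : 0 ≤ δ') (hϖ : ∀ b', 0 ≤ ϖ b')
    {𝒴e' 𝒳e 𝒵e ℬe : Type*} [NormedAddCommGroup 𝒴e'] [NormedSpace ℂ 𝒴e'] [NormedAddCommGroup 𝒳e] [NormedSpace ℂ 𝒳e]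
    [CompleteSpace 𝒳e] [NormedAddCommGroup 𝒵e] [NormedSpace ℂ 𝒵e] [NormedAddCommGroup ℬe] [NormedSpace ℂ ℬe]
    (𝒢e : GaugeField P j SU2 → (𝒵e →L[ℂ] WSup (pinW δ' ϖ) 1 𝔄)) (W𝒱e : GaugeField P j SU2 → WSup (pinW δ' ϖ) 1 𝔄 → 𝒵e)
    {B₀e C₄e a₃e be ε₄e : ℝ}
    (h𝒢e : ∀ V f, ‖𝒢e V f‖ ≤ B₀e * ‖f‖) (hWe : ∀ V, Prop4Hyp (W𝒱e V) C₄e a₃e) (hB₀e : 0 < B₀e) (hC₄e : 0 ≤ C₄e)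
    (hbe : 0 ≤ be) (hε₄e : 0 ≤ ε₄e) (hdome : 2 * (ε₄e + B₀e * be) ≤ a₃e)
    (hselfe : B₀e * C₄e * (ε₄e + B₀e * be) ^ 2 ≤ ε₄e) (hcontre : 4 * B₀e * C₄e * (ε₄e + B₀e * be) < 1)
    (H₁e : GaugeField P j SU2 → (ℬe →L[ℂ] WSup (pinW δ' ϖ) 1 𝔄)) (hH₁e : ∀ V B, ‖H₁e V B‖ ≤ B₀e * ‖B‖)
    (Φe : GaugeField P j SU2 → (Fin m₀ → ℂ) → ℬe) {rΦe : ℝ} (hΦde : ∀ V, DifferentiableOn ℂ (Φe V) (ball 0 rΦe))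
    (hΦ0e : ∀ V, Φe V 0 = 0) (hΦbe : ∀ V, ∀ z ∈ ball (0 : Fin m₀ → ℂ) rΦe, ‖Φe V z‖ < be) (hSre : S < rΦe)
    (Ce : GaugeField P j SU2 → 𝒴e' → 𝒳e) {C₂e RCe : ℝ} (hC₂e : 0 ≤ C₂e)
    (hCqe : ∀ V, ∀ Z : 𝒴e', ‖Z‖ < RCe → ‖Ce V Z‖ ≤ C₂e * ‖Z‖ ^ 2) (hCde : ∀ V, DifferentiableOn ℂ (Ce V) (ball 0 RCe))
    (ιe : GaugeField P j SU2 → (WSup (pinW δ' ϖ) 1 𝔄 →L[ℂ] 𝒴e')) (hιe : ∀ V Y, ‖ιe V Y‖ ≤ ‖Y‖)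
    (He : GaugeField P j SU2 → (𝒳e →L[ℂ] WSup (pinW δ' ϖ) 1 𝔄)) (hHe : ∀ V X, ‖He V X‖ ≤ B₀e * ‖X‖)
    (hqe : 9 * C₂e * B₀e * (ε₄e + B₀e * be) < 1) (hRCe : 3 * (ε₄e + B₀e * be) ≤ RCe)
    {𝔱 : Type*} (I : Finset 𝔱) {Ef : 𝔱 → (Λe → 𝔄) → ℂ} {rE : ℝ} {ee : 𝔱 → ℝ} (hrE : 0 < rE)
    (hEd : ∀ i ∈ I, DifferentiableOn ℂ (Ef i) (ball 0 rE))
    (hEb : ∀ i ∈ I, ∀ Z ∈ ball (0 : Λe → 𝔄) rE, ‖Ef i Z‖ ≤ ee i) (he0 : ∀ i ∈ I, 0 ≤ ee i)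
    (supp : 𝔱 → Finset Λe) (hblind : ∀ i ∈ I, ∀ A₁ A₂ : Λe → 𝔄, (∀ b' ∈ supp i, A₁ b' = A₂ b') → Ef i A₁ = Ef i A₂)
    (ϖP : 𝔱 → ℝ) (hdepth : ∀ i ∈ I, ∀ b' ∈ supp i, ϖP i ≤ ϖ b')
    {LK : ℝ} (hLK : 0 ≤ LK) (hK : ∑ i ∈ I, 2 * ee i / rE * Real.exp (-(δ' * ϖP i)) ≤ LK)
    (hcoupE : ((ε₄e + B₀e * be) + B₀e * (4 * C₂e * (ε₄e + B₀e * be) ^ 2)) ≤ rE / 2)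
    {BE₁ : ℝ} (hElb₁ : ∀ V (y : Fin m₀ → ℝ), ‖y‖ ≤ S → -BE₁ ≤
      (∑ i ∈ I, Ef i (WSup.toPiL (𝔄 := 𝔄) (pinW δ' ϖ) 1
        (landauExp (Ce V) (ιe V) (He V) (4 * C₂e * (ε₄e + B₀e * be) ^ 2)
          (solAt (𝒢e V) 0 (W𝒱e V) ε₄e (0 : 𝒵e) (H₁e V (Φe V (cplx y))) + H₁e V (Φe V (cplx y)))))).re)
    -- ══ (S78) THE FLUCTUATION-DRESSED TERMS: `−log ∫ g e^{A} dμ` with an ω-UNIFORM ray constant `B_d`, integrability and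
    -- positivity of the dressed integral, a lower bound on the S-ball (all DISPLAYED) ══
    {Ω : Type*} [MeasurableSpace Ω] (μ : Measure Ω) {g : Ω → ℝ} (hg : ∀ ω, 0 ≤ g ω)
    (A : GaugeField P j SU2 → (Fin m₀ → ℝ) → Ω → ℝ) {Bd : ℝ} (hBd0 : 0 ≤ Bd)
    (hint : ∀ V, ∀ x ∈ W V, ∀ c : ℝ, 1 / 2 ≤ c → c ≤ 1 → Integrable (fun ω => g ω * Real.exp (A V (c • x) ω)) μ)
    (hpos : ∀ V, ∀ x ∈ W V, ∀ c : ℝ, 1 / 2 ≤ c → c ≤ 1 → 0 < ∫ ω, g ω * Real.exp (A V (c • x) ω) ∂μ)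
    (hA : ∀ V, ∀ x ∈ W V, ∀ c : ℝ, 1 / 2 ≤ c → c ≤ 1 → ∀ ω, A V x ω ≤ A V (c • x) ω + (1 - c) * Bd)
    {BE₂ : ℝ} (hElb₂ : ∀ V (y : Fin m₀ → ℝ), ‖y‖ ≤ S → -BE₂ ≤ (-Real.log (∫ ω, g ω * Real.exp (A V y ω) ∂μ)))
    (L : Set (𝒴 →L[ℂ] Matrix n n ℂ))
    (𝓡𝒵 : AddSubgroup 𝒵) (𝓡𝒴' : AddSubgroup 𝒴') (𝓡𝒳 : AddSubgroup 𝒳) (h𝓡𝒳 : IsClosed (𝓡𝒳 : Set 𝒳))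
    (𝓡ℬ : AddSubgroup ℬ)
    (h𝒢r : ∀ V, ∀ f ∈ 𝓡𝒵, 𝒢 V f ∈ readOutReal L) (hWr : ∀ V, ∀ Y ∈ readOutReal L, W𝒱 V Y ∈ 𝓡𝒵)
    (hιr : ∀ V, ∀ Y ∈ readOutReal L, ιs V Y ∈ 𝓡𝒴') (hHr : ∀ V, ∀ X ∈ 𝓡𝒳, Hop V X ∈ readOutReal L)
    (hCr : ∀ V, ∀ Z ∈ 𝓡𝒴', Cf V Z ∈ 𝓡𝒳) (hH₁r : ∀ V, ∀ B ∈ 𝓡ℬ, H₁ V B ∈ readOutReal L)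
    (hΦr : ∀ V, ∀ y : Fin m₀ → ℝ, ‖y‖ ≤ S → Φ V (cplx y) ∈ 𝓡ℬ)
    (hRdict : ∀ V, ∀ x ∈ cube m₀ S,
      F (fixTo T U₀ (updateFinset V Λ (expFibreChart Λ (c V) e x))) =
        Jco V x * ENNReal.ofReal (Real.exp (-((∑ p ∈ Pw, β * (1 - (Matrix.trace (Bp V p * holOf (ℓw p)
            (fun y => landauExp (Cw V) (ιw V) (Hw V) (4 * C₂w * (ε₄w + B₀w * bw) ^ 2)
              (solAt (𝒢w V) 0 (W𝒱w V) ε₄w (0 : 𝒵w) (H₁w V (Φw V (cplx y))) + H₁w V (Φw V (cplx y)))) x)).re /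
            Fintype.card n)) +
          ((∑ i ∈ I, Ef i (WSup.toPiL (𝔄 := 𝔄) (pinW δ' ϖ) 1
            (landauExp (Ce V) (ιe V) (He V) (4 * C₂e * (ε₄e + B₀e * be) ^ 2)
              (solAt (𝒢e V) 0 (W𝒱e V) ε₄e (0 : 𝒵e) (H₁e V (Φe V (cplx x))) + H₁e V (Φe V (cplx x)))))).re +
          (-Real.log (∫ ω, g ω * Real.exp (A V x ω) ∂μ)))))))
    (hudict : ∀ V, ∀ x ∈ cube m₀ S,
      u (fixTo T U₀ (updateFinset V Λ (expFibreChart Λ (c V) e x))) =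
        classifier hPu (fun p => holOf (ℓs p) (fun y => landauExp (Cf V) (ιs V) (Hop V)
          (4 * C₂ * (ε₄ + B₀ * (2 * dL * C₁ * ε₁)) ^ 2)
          (solAt (𝒢 V) 0 (W𝒱 V) ε₄ (0 : 𝒵) (H₁ V (Φ V (cplx y))) + H₁ V (Φ V (cplx y))))) x)
    (hJW : ∀ V x, Jco V x ≠ 0 → x ∈ W V)
    (hJ : ∀ V x, ∀ a : ℝ, 0 ≤ a → Jco V x ≤ Jco V (Real.exp (-a) • x))
    (hJ1 : ∀ V x, Jco V x ≤ 1)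
    (hWS : ∀ V, W V ⊆ closedBall (0 : Fin m₀ → ℝ) S)
    (hδ0 : 0 ≤ δ) (hδ1 : δ < 1) (hρ0 : 0 ≤ ρ) (hρ : ρ ≤ (1 - δ) / 2) (hβ : 0 ≤ β)
    -- SM-L2 (SM) DISCHARGED IN THE STOKES CURRENCY (S73 `hSM_of_stokes`): the η-scalings of the classifier's read-out data
    -- DISPLAYED — curl read-out × field size `κ_c·z̄ ≤ c₁η²z` (B11 (25)∕(37) TYPE), letter size `κ_r·z̄ ≤ c₂ηz` ((19) TYPE),
    -- regime `m·κ_r·z̄ ≤ 1` — the UNIT-currency smallness `36(c₁z + m²c₂²z²)∕(r_Φ∕S − 1)² ≤ δ·εθ`, and the classifier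
    -- threshold `θ := εθ·η²` (B14 (2.17) TYPE): the `η²` CANCELS
    {η εθ c₁ c₂ z : ℝ} (hη : 0 < η) (hεθ : 0 < εθ)
    (hs₁ : κc * ((ε₄ + B₀ * (2 * dL * C₁ * ε₁)) + B₀ * (4 * C₂ * (ε₄ + B₀ * (2 * dL * C₁ * ε₁)) ^ 2)) ≤ c₁ * η ^ 2 * z)
    (ha : κr * ((ε₄ + B₀ * (2 * dL * C₁ * ε₁)) + B₀ * (4 * C₂ * (ε₄ + B₀ * (2 * dL * C₁ * ε₁)) ^ 2)) ≤ c₂ * η * z)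
    (hma : m * (κr * ((ε₄ + B₀ * (2 * dL * C₁ * ε₁)) + B₀ * (4 * C₂ * (ε₄ + B₀ * (2 * dL * C₁ * ε₁)) ^ 2))) ≤ 1)
    (hsm : 36 * (c₁ * z + m ^ 2 * c₂ ^ 2 * z ^ 2) / (rΦ / S - 1) ^ 2 ≤ δ * εθ) :
    SlotAntiConcentration ((fieldMeasure P j SU2).withDensity F) u (εθ * η ^ 2) ρ
      (2 * ((m₀ : ℝ) + (3 * Hbar / (rΦw / S - 1) +
        (3 * (LK * (2 * ((ε₄e + B₀e * be) + B₀e * (4 * C₂e * (ε₄e + B₀e * be) ^ 2)))) / (rΦe / S - 1) + Bd))) / (1 - δ)) := by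
  have hRadw : 1 < rΦw / S := by rw [lt_div_iff₀ hS]; linarith
  have hRade : 1 < rΦe / S := by rw [lt_div_iff₀ hS]; linarith
  have hzE : 0 ≤ ((ε₄e + B₀e * be) + B₀e * (4 * C₂e * (ε₄e + B₀e * be) ^ 2)) := by positivity
  have hBW : 0 ≤ 3 * Hbar / (rΦw / S - 1) := div_nonneg (by positivity) (by linarith)
  have hBE : 0 ≤ 3 * (LK * (2 * ((ε₄e + B₀e * be) + B₀e * (4 * C₂e * (ε₄e + B₀e * be) ^ 2)))) / (rΦe / S - 1) + Bd :=
    add_nonneg (div_nonneg (by positivity) (by linarith)) hBd0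
  refine slotAC_realized_su2_landauChart_final hT U₀ Λ e hS hSπ c hF hFi hFsupp hu hui hPu W Jco 𝒢 W𝒱 h𝒢 hW hB₀
    hC₄ hε₄ hdL hC₁ hε₁ hB₃ h1 h2 h3 H₁ hH₁ Φ hΦd hΦ0 hΦ hSr Cf hC₂ hCq hCd ιs hι Hop hH h18 hcoup h3R ℓs hκ hℓ hlen
    hκc hcurl
    (fun V y => ∑ p ∈ Pw, β * (1 - (Matrix.trace (Bp V p * holOf (ℓw p)
      (fun y => landauExp (Cw V) (ιw V) (Hw V) (4 * C₂w * (ε₄w + B₀w * bw) ^ 2)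
        (solAt (𝒢w V) 0 (W𝒱w V) ε₄w (0 : 𝒵w) (H₁w V (Φw V (cplx y))) + H₁w V (Φw V (cplx y)))) y)).re /
          Fintype.card n))
    (fun V y => (∑ i ∈ I, Ef i (WSup.toPiL (𝔄 := 𝔄) (pinW δ' ϖ) 1
      (landauExp (Ce V) (ιe V) (He V) (4 * C₂e * (ε₄e + B₀e * be) ^ 2)
        (solAt (𝒢e V) 0 (W𝒱e V) ε₄e (0 : 𝒵e) (H₁e V (Φe V (cplx y))) + H₁e V (Φe V (cplx y)))))).re +
      (-Real.log (∫ ω, g ω * Real.exp (A V y ω) ∂μ)))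
    (BElb := BE₁ + BE₂)
    (fun V x hx c' hc hc1 => ?_) hBW (fun V x hx c' hc hc1 => ?_) hBE (fun V y hy => ?_) (fun V y hy => ?_)
    L 𝓡𝒵 𝓡𝒴' 𝓡𝒳 h𝓡𝒳 𝓡ℬ h𝒢r hWr hιr hHr hCr hH₁r hΦr (fun V x hx => by simpa only using hRdict V x hx) hudict hJW hJ
    hJ1 hWS hδ0 hδ1 hρ0 hρ hβ hη hεθ hs₁ ha hma hsm
  · -- the WILSON slot: S74 f2 per exterior section
    exact hE_landau_wilsonSquares_pinned hS (hWS V) (h𝒢w V) (hWw V) hB₀w hC₄w hε₄w hdomw hselfw hcontrw (H₁w V)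
      (hH₁w V) (hΦdw V) (hΦ0w V) (hΦbw V) hSrw hC₂w (hCqw V) (hCdw V) (ιw V) (hιw V) (Hw V) (hHw V) hqw hRCw
      π𝒴 π𝒴' π𝒳 πℬ (hGWp V) hqW (hCp V) (hιp V) (hHp V) hLC hcι hBH hk hB₁p (hH₁p V) (hΦp V) hbp ℓw hκw hκcw hℓwπ
      hcurlπ hlenw 𝓡𝒴w h𝓡𝒴w 𝓡𝒵w 𝓡𝒴w' 𝓡𝒳w h𝓡𝒳w 𝓡ℬw (h𝒢rw V) (hWrw V) (hιrw V) (hHrw V) (hCrw V) (hH₁rw V)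
      (hΦrw V) hskew (Bp V) (hBu V) (hBd V) hsumw x hx c' hc hc1
  · -- the NON-WILSON slot: S71 f2 located terms ⊕ S78 dressed terms (`rayBound_add`)
    have h1 := hE_landau_chartRay_pinned hδ' hϖ hS (hWS V) (h𝒢e V) (hWe V) hB₀e hC₄e hε₄e hdome hselfe hcontre
      (H₁e V) (hH₁e V) (hΦde V) (hΦ0e V) (hΦbe V) hSre hC₂e (hCqe V) (hCde V) (ιe V) (hιe V) (He V) (hHe V) hqe hRCe
      I hrE hEd hEb he0 supp hblind ϖP hdepth hK hcoupE x hx c' hc hc1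
    have h2 := rayBound_of_logIntegral μ hg (A V) (hint V) (hpos V) (hA V) x hx c' hc hc1
    simp only at h1 h2 ⊢
    linarith
  · -- the Wilson profile is nonnegative at real chart points (§1b)
    exact wilsonProfile_nonneg Pw (h𝒢w V) (hWw V) hB₀w hC₄w hε₄w hdomw hselfw hcontrw (H₁w V) (hH₁w V) (hΦbw V) hSrw
      hC₂w (hCqw V) (hCdw V) (ιw V) (hιw V) (Hw V) (hHw V) hqw hRCw ℓw 𝓡𝒴w h𝓡𝒴w 𝓡𝒵w 𝓡𝒴w' 𝓡𝒳w h𝓡𝒳w 𝓡ℬw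
      (h𝒢rw V) (hWrw V) (hιrw V) (hHrw V) (hCrw V) (hH₁rw V) (hΦrw V) hskew (Bp V) (hBu V) hβ hy
  · -- the lower bound of the non-Wilson part
    have h1 := hElb₁ V y hy
    have h2 := hElb₂ V y hy
    linarith

end Assembled

end Summit.QuantumFields.BalabanUV.T4Continuum.ShellMeasureLandauEndRayStokesAssembled

end
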